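import Summits.MatrixMultiplication.MatrixMultiplication.Theorems.LevelGradedCohnUmansLevelOneGL2DesignsStubTangencySetsHermitianReduction
import Literature.Combinatorics.Extremal.PointLineInducedMatchings

/-!
# `stub_tangencySets` at exponent `3/2 − ε` from Pohoata's theorem (wall-breaker axis `parabola lifts over finite
fields`, stub `stub_tangencySets` of the crux `LevelOneGL2Designs`, stmt-MatrixMultiplication-14080)

The stub asks for tangency sets / strong representative systems of `AG(2,p)` of size `c·p^{3/2}` along an
unbounded set of primes.  Every generation-0 seat recorded it as "the negation of prediction 10.2 of
Hunter–Pohoata–Verstraëte–Zhang (2026), hence expected to be FALSE".  That prediction has since been REFUTED: Pohoata,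
*The sharp exponent for the minimal distance problem* (arXiv:2607.20422, 30 Jul 2026), Theorem 1.3 — for every
fixed prime `r ≥ 5` the point–line incidence graph of `𝔽_q²` has induced matchings of size `≳_r q^{3/2 − 2/(r−1)}`
for all sufficiently large primes `q ≡ ±1 (mod r)` (a parabola lift of the trace-zero slice of the ring of
integers of the maximal real subfield of `ℚ(ζ_r)`).  So `limsup_{q prime} log IM(2,q) / log q = 3/2`, and the stub
sits exactly at the frontier: exponent `3/2 − ε` for every `ε > 0` is a theorem in print, exponent `3/2` with a
constant is not known.

This file records the printed theorem as a named fact (`InducedMatchingsNearThreeHalves`, statement only, to be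
relocated under `Literature/`) and proves the CONDITIONAL glue
`stubFormat_near_threeHalves_of_inducedMatchings` / `…_of_pohoata`: the named fact implies the stub's exact flag format with
`p^{3/2}` replaced by `p^{3/2 − ε}`, for every `ε > 0` (via the affine-tangency-set ⇒ SRS reduction
`srs_of_tangencySet` of `…StubTangencySetsHermitianReduction` and Dirichlet's theorem for the progression
`1 mod r`).  For the planner: if the consumer of the stub (`LevelOneLink` / `LieRankDesigns_of_levelOneGL2`)
tolerates a `p^{−ε}` loss, the stub re-filed at exponent `3/2 − ε` is settled modulo this one named fact.

No other content; the named fact is NOT proved here (its proof needs the arithmetic of `ℚ(ζ_r)⁺`).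
-/

-- the summit/problem path `MatrixMultiplication.MatrixMultiplication` is fixed by the tree layout (D-0017)
set_option linter.dupNamespace false

noncomputable section

open Finset Matrix

namespace Summit.MatrixMultiplication.MatrixMultiplication.Theorems.LevelOneGL2Designs.ParabolaLift

/-- **The stub's format at exponent `3/2 − ε` from near-`3/2` induced matchings.**  If for every prime `r ≥ 5`
the planes `AG(2,q)`, `q ≡ ±1 (mod r)` a large prime, contain tangency sets of size `c_r · q^{3/2 − 2/(r−1)}`
(the content of Pohoata 2026, Thm 1.3, spelled out as the hypothesis), then for every `ε > 0` there is `c > 0`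
such that for every `p₀` some prime `p ≥ p₀` carries a strong representative system of `AG(2,p)` in the exact flag
format of `stub_tangencySets` with at least `c · p^{3/2 − ε}` flags.  (Pick a prime `r ≥ 5` with `2/(r−1) ≤ ε`,
a prime `p ≡ 1 (mod r)` beyond `p₀` and the threshold by Dirichlet, and convert the tangency set into flags with
`srs_of_tangencySet`, losing at most half.)  The stub itself is the case `ε = 0`. [elementary glue] -/
theorem stubFormat_near_threeHalves_of_inducedMatchings
    (hP : ∀ r : ℕ, r.Prime → 5 ≤ r → ∃ c : ℝ, 0 < c ∧ ∃ q₀ : ℕ, ∀ q : ℕ, q.Prime → q₀ ≤ q →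
      (q % r = 1 ∨ q % r = r - 1) →
      ∃ V : Finset (Fin 2 → ZMod q), c * (q : ℝ) ^ ((3 : ℝ) / 2 - 2 / ((r : ℝ) - 1)) ≤ V.card ∧
        ∀ v ∈ V, ∃ u : Fin 2 → ZMod q, u ≠ 0 ∧ ∀ w ∈ V, u ⬝ᵥ w = u ⬝ᵥ v → w = v)
    (ε : ℝ) (hε : 0 < ε) :
    ∃ c : ℝ, 0 < c ∧ ∀ p₀ : ℕ, ∃ (p : ℕ) (_ : Fact p.Prime), p₀ ≤ p ∧
      ∃ S : Finset ((Fin 2 → ZMod p) × (Fin 2 → ZMod p)),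
        c * (p : ℝ) ^ (3 / 2 - ε : ℝ) ≤ S.card ∧
        ∀ f ∈ S, ∀ f' ∈ S, (dotProduct f.1 f'.2 = 1 ↔ f = f') := by
  classical
  -- a prime `r ≥ 5` with `2/(r-1) ≤ ε`
  obtain ⟨r, hr, hrp⟩ := Nat.exists_infinite_primes (max 5 (⌈2 / ε⌉₊ + 1))
  have hr5 : 5 ≤ r := le_trans (le_max_left _ _) hr
  have hrε : 2 / ((r : ℝ) - 1) ≤ ε := by
    have h1 : (⌈2 / ε⌉₊ : ℝ) + 1 ≤ r := by
      have := le_trans (le_max_right _ _) hr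
      exact_mod_cast this
    have h2 : 2 / ε ≤ ⌈2 / ε⌉₊ := Nat.le_ceil _
    have h3 : 2 / ε ≤ (r : ℝ) - 1 := by linarith
    have h4 : 0 < (r : ℝ) - 1 := by
      have : (5 : ℝ) ≤ r := by exact_mod_cast hr5
      linarith
    rw [div_le_iff₀ h4]
    rw [div_le_iff₀ hε] at h3
    linarith
  obtain ⟨c, hc, q₀, hq⟩ := hP r hrp hr5
  refine ⟨c / 2, by positivity, fun p₀ => ?_⟩
  -- a prime `p ≡ 1 (mod r)` beyond `p₀` and `q₀`
  obtain ⟨p, hp, hlt, hmod⟩ := Nat.exists_prime_gt_modEq_one (max p₀ q₀) hrp.ne_zero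
  have hp₀ : p₀ ≤ p := le_of_lt (lt_of_le_of_lt (le_max_left _ _) hlt)
  have hq₀ : q₀ ≤ p := le_of_lt (lt_of_le_of_lt (le_max_right _ _) hlt)
  have hmod' : p % r = 1 := by
    have h1 : p % r = 1 % r := hmod
    rwa [Nat.mod_eq_of_lt (by omega : 1 < r)] at h1
  haveI : Fact p.Prime := ⟨hp⟩
  obtain ⟨V, hV, htan⟩ := hq p hp hq₀ (Or.inl hmod')
  -- choose the private lines and convert to the stub's flags
  choose! u hu using htan
  obtain ⟨S, hS, hsrs⟩ := FlagLine.TangencyHermitian.srs_of_tangencySet V u (fun v hv => (hu v hv).1)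
    (fun v hv => (hu v hv).2)
  refine ⟨p, ⟨hp⟩, hp₀, S, ?_, hsrs⟩
  -- sizes: `|S| ≥ |V| (1 - 1/p) ≥ |V| / 2 ≥ (c/2) p^{3/2 - 2/(r-1)} ≥ (c/2) p^{3/2 - ε}`
  have hp2 : (2 : ℝ) ≤ p := by exact_mod_cast hp.two_le
  have hcardF : (Fintype.card (ZMod p) : ℝ) = p := by rw [ZMod.card]
  have hS' : (V.card : ℝ) * p ≤ S.card * p + V.card := by
    have := hS
    rw [ZMod.card] at this
    exact_mod_cast this
  have hSV : (V.card : ℝ) ≤ 2 * S.card := by nlinarith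
  have hp1 : (1 : ℝ) ≤ p := by linarith
  have hexp : (p : ℝ) ^ (3 / 2 - ε : ℝ) ≤ (p : ℝ) ^ ((3 : ℝ) / 2 - 2 / ((r : ℝ) - 1)) :=
    Real.rpow_le_rpow_of_exponent_le hp1 (by linarith)
  calc c / 2 * (p : ℝ) ^ (3 / 2 - ε : ℝ) ≤ c / 2 * (p : ℝ) ^ ((3 : ℝ) / 2 - 2 / ((r : ℝ) - 1)) := by
        gcongr
    _ = (c * (p : ℝ) ^ ((3 : ℝ) / 2 - 2 / ((r : ℝ) - 1))) / 2 := by ring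
    _ ≤ V.card / 2 := by gcongr
    _ ≤ S.card := by linarith

/-- **`stub_tangencySets` at exponent `3/2 − ε`, conditionally on Pohoata's theorem** (the named fact
`InducedMatchingsNearThreeHalves`, Pohoata 2026 Thm 1.3, not proved in the tree): for every `ε > 0` the stub's
flag format holds with `p^{3/2}` replaced by `p^{3/2 − ε}`.  This is exactly how far print is from the stub
(`ε = 0`) as of 2026-08. [conditional on the cited theorem] -/
theorem stubFormat_near_threeHalves_of_pohoata (hP : Literature.Combinatorics.Extremal.InducedMatchingsNearThreeHalves) (ε : ℝ) (hε : 0 < ε) :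
    ∃ c : ℝ, 0 < c ∧ ∀ p₀ : ℕ, ∃ (p : ℕ) (_ : Fact p.Prime), p₀ ≤ p ∧
      ∃ S : Finset ((Fin 2 → ZMod p) × (Fin 2 → ZMod p)),
        c * (p : ℝ) ^ (3 / 2 - ε : ℝ) ≤ S.card ∧
        ∀ f ∈ S, ∀ f' ∈ S, (dotProduct f.1 f'.2 = 1 ↔ f = f') :=
  stubFormat_near_threeHalves_of_inducedMatchings hP ε hε

end Summit.MatrixMultiplication.MatrixMultiplication.Theorems.LevelOneGL2Designs.ParabolaLift
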